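import Summits.AtomisticToContinuum.HydrodynamicLimit.Theses.JParityClosure
import Literature.MathematicalPhysics.KineticTheory.HardSphereEulerProofs
import Literature.MathematicalPhysics.KineticTheory.HardSphereUniformGas
import Summits.AtomisticToContinuum.HydrodynamicLimit.Theorems.JParityClosureOddContactSymmetryFluxLeGibbs
import Mathlib.MeasureTheory.Integral.Marginal
import HarnessLib

/-!
# Fixed-ball void estimate, I: one step of the level comparison (V1 of P4)

Crux `JParityClosure.OddContactSymmetry` (stmt-AtomisticToContinuum-17722), line `KineticSlabSketch`,
piece V1 (`stub_fixedBallVoid`, fixed-ball void estimate for the dilute canonical hard-sphere gas on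
`𝕋³`), first half, registered helper stub `stub_fixedBallVoidLevel`: for the configurational canonical
Gibbs measure of `n` hard spheres of diameter `ε < 1/2` with unit activity, the occupation number
`occ(x) = #{k | dist(x_k, c) < R}` of a fixed ball `B = B(c, R)` satisfies the LEVEL COMPARISON

  `(n − m) · w · vol(E_m ∩ D) ≤ (m + 1) · vol(E_{m+1} ∩ D)`,  `E_m = {occ = m}`, `D` = no overlap,

for every `w` with `w + m |B_ε| ≤ vol B(c, R − ε)` (`volume_occLevel_step`), hence
`2 P(occ = m) ≤ P(occ = m + 1)` as soon as `2 (m + 1) ≤ (n − m) w` (`posGibbs_occLevel_step`).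

Proof (elementary, no cluster expansion).  For every label `l`, integrate the coordinate `x_l`
innermost (Tonelli over one coordinate of `(𝕋³)^n`, `lintegral_pi_le_of_update_le`): over a frozen
configuration of the other `n − 1` centres, the fibre of `E_m ∩ D ∩ {x_l ∉ B}` has Haar measure `≤ 1`
and is empty unless the frozen centres do not overlap and exactly `m` of them lie in `B`, in which case
the fibre of `E_{m+1} ∩ D ∩ {x_l ∈ B}` is the FREE VOLUME `vol{q ∈ B | dist(q, x_k) ≥ ε ∀ k ≠ l}`,
which is `≥ vol B(c, R − ε) − m |B_ε|`: a point of `B(c, R − ε)` is only blocked by a centre inside `B`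
(triangle inequality).  Summing over `l` counts `E_m ∩ D` exactly `n − m` times on the left and
`E_{m+1} ∩ D` exactly `m + 1` times on the right.
-/

noncomputable section

open scoped BigOperators Classical InnerProductSpace ENNReal Topology
open Set MeasureTheory Filter
open Literature.Analysis.FluidPDE Literature.MathematicalPhysics.KineticTheory

namespace Summit.AtomisticToContinuum.HydrodynamicLimit.Theorems.OddContactSymmetryKineticSlab

/-! ### Measurability of the occupation events -/

/-- The minimal-image distance of the `k`-th centre to a fixed point is measurable. [folklore] -/
theorem measurable_euclidDist_apply {n : ℕ} (k : Fin n) (c : T3) :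
    Measurable fun x : Fin n → T3 => Torus.euclidDist (x k) c := by
  have hk : Measurable fun x : Fin n → T3 => x k := measurable_pi_apply k
  have h : Measurable fun x : Fin n → T3 => ‖(Torus.geometry (Fin 3)).sepVec (x k) c‖ :=
    (Torus.measurable_geometry_sepVec.comp (hk.prodMk measurable_const)).norm
  exact h

/-- The minimal-image distance to a fixed point is measurable. [folklore] -/
theorem measurable_euclidDist_left (c : T3) : Measurable fun q : T3 => Torus.euclidDist q c := by
  have h : Measurable fun q : T3 => ‖(Torus.geometry (Fin 3)).sepVec q c‖ :=
    (Torus.measurable_geometry_sepVec.comp (measurable_id.prodMk measurable_const)).norm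
  exact h

/-- The event "the `k`-th centre lies in the ball `B(c, R)`" is measurable. [folklore] -/
theorem measurableSet_euclidDist_apply_lt {n : ℕ} (k : Fin n) (c : T3) (R : ℝ) :
    MeasurableSet {x : Fin n → T3 | Torus.euclidDist (x k) c < R} :=
  measurableSet_lt (measurable_euclidDist_apply k c) measurable_const

/-- The occupation number of the ball `B(c, R)` is a measurable (real-valued) function. [folklore] -/
theorem measurable_occ_real (n : ℕ) (c : T3) (R : ℝ) :
    Measurable fun x : Fin n → T3 =>
      ((Finset.univ.filter fun k : Fin n => Torus.euclidDist (x k) c < R).card : ℝ) := by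
  have h : (fun x : Fin n → T3 =>
      ((Finset.univ.filter fun k : Fin n => Torus.euclidDist (x k) c < R).card : ℝ)) =
      fun x => ∑ k : Fin n, if Torus.euclidDist (x k) c < R then (1 : ℝ) else 0 := by
    funext x
    rw [Finset.sum_boole]
  rw [h]
  refine Finset.measurable_sum _ fun k _ => Measurable.ite ?_ measurable_const measurable_const
  exact measurableSet_euclidDist_apply_lt k c R

/-- The occupation levels `{occ = m}` of the ball `B(c, R)` are measurable. [folklore] -/
theorem measurableSet_occ_eq (n : ℕ) (c : T3) (R : ℝ) (m : ℕ) :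
    MeasurableSet {x : Fin n → T3 |
      (Finset.univ.filter fun k : Fin n => Torus.euclidDist (x k) c < R).card = m} := by
  have h : {x : Fin n → T3 | (Finset.univ.filter fun k : Fin n => Torus.euclidDist (x k) c < R).card = m} =
      (fun x : Fin n → T3 =>
        ((Finset.univ.filter fun k : Fin n => Torus.euclidDist (x k) c < R).card : ℝ)) ⁻¹' {(m : ℝ)} := by
    ext x
    simp only [mem_setOf_eq, mem_preimage, mem_singleton_iff, Nat.cast_inj]
  rw [h]
  exact measurable_occ_real n c R (measurableSet_singleton _)

/-! ### The fibres over one coordinate -/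

/-- Occupation number after moving the `l`-th centre to `q`: the occupation of the other centres plus
`𝟙[q ∈ B]`. [folklore] -/
theorem occ_update_eq {n : ℕ} (c : T3) (R : ℝ) (x : Fin n → T3) (l : Fin n) (q : T3) :
    (Finset.univ.filter fun k : Fin n => Torus.euclidDist (Function.update x l q k) c < R).card =
      ((Finset.univ.erase l).filter fun k : Fin n => Torus.euclidDist (x k) c < R).card +
        (if Torus.euclidDist q c < R then 1 else 0) := by
  rw [Finset.card_filter, Finset.card_filter, ← Finset.add_sum_erase _ _ (Finset.mem_univ l),
    add_comm]
  simp only [Function.update_self]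
  congr 1
  refine Finset.sum_congr rfl fun k hk => ?_
  rw [Function.update_of_ne (Finset.ne_of_mem_erase hk)]

/-- Non-overlap after moving the `l`-th centre to `q`: the other centres do not overlap and `q` is
`ε`-clear of them. [folklore] -/
theorem update_mem_posDomain_iff {n : ℕ} (ε : ℝ) (x : Fin n → T3) (l : Fin n) (q : T3) :
    Function.update x l q ∈ posDomain ε n ↔
      (∀ i j, i ≠ j → i ≠ l → j ≠ l → ε ≤ Torus.euclidDist (x i) (x j)) ∧
        ∀ k, k ≠ l → ε ≤ Torus.euclidDist q (x k) := by
  simp only [posDomain, mem_setOf_eq]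
  constructor
  · intro h
    refine ⟨fun i j hij hil hjl => ?_, fun k hkl => ?_⟩
    · have h1 := h i j hij
      rwa [Function.update_of_ne hil, Function.update_of_ne hjl] at h1
    · have h1 := h l k (Ne.symm hkl)
      rwa [Function.update_self, Function.update_of_ne hkl] at h1
  · rintro ⟨h1, h2⟩ i j hij
    by_cases hil : i = l
    · subst hil
      rw [Function.update_self, Function.update_of_ne (Ne.symm hij)]
      exact h2 j (Ne.symm hij)
    · by_cases hjl : j = l
      · subst hjl
        rw [Function.update_self, Function.update_of_ne hil, Torus.euclidDist_comm]
        exact h2 i hil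
      · rw [Function.update_of_ne hil, Function.update_of_ne hjl]
        exact h1 i j hij hil hjl

/-- **The fibre inequality.** Freeze all centres but the `l`-th.  The fibre of
`E_m ∩ D ∩ {x_l ∉ B}` has Haar measure `≤ w`, the fibre of `E_{m+1} ∩ D ∩ {x_l ∈ B}` is the free
volume `vol{q ∈ B | dist(q, x_k) ≥ ε ∀ k ≠ l} ≥ vol B(c, R−ε) − m |B_ε| ≥ w` (both fibres are empty
unless the frozen centres do not overlap and exactly `m` of them lie in `B`). [folklore] -/
theorem lintegral_update_occLevel_le {n : ℕ} {ε R : ℝ} (hε : 0 ≤ ε) (hε2 : ε < 1 / 2) (c : T3)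
    (m : ℕ) (l : Fin n) {w : ℝ≥0∞}
    (hw : w + m * volume (Metric.ball (0 : V3) ε) ≤ volume {q : T3 | Torus.euclidDist q c < R - ε})
    (x : Fin n → T3) :
    ∫⁻ q, ({x : Fin n → T3 |
          (Finset.univ.filter fun k : Fin n => Torus.euclidDist (x k) c < R).card = m} ∩
        posDomain ε n ∩ {x | ¬Torus.euclidDist (x l) c < R}).indicator (fun _ => w)
        (Function.update x l q) ≤
      ∫⁻ q, ({x : Fin n → T3 |
          (Finset.univ.filter fun k : Fin n => Torus.euclidDist (x k) c < R).card = m + 1} ∩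
        posDomain ε n ∩ {x | Torus.euclidDist (x l) c < R}).indicator 1 (Function.update x l q) := by
  set occl := ((Finset.univ.erase l).filter fun k : Fin n => Torus.euclidDist (x k) c < R).card
    with hoccl
  by_cases hx : (∀ i j, i ≠ j → i ≠ l → j ≠ l → ε ≤ Torus.euclidDist (x i) (x j)) ∧ occl = m
  · -- the free set of the moving centre inside the ball
    set S : Set T3 := {q | Torus.euclidDist q c < R ∧ ∀ k, k ≠ l → ε ≤ Torus.euclidDist q (x k)}
      with hS
    have hSm : MeasurableSet S := by
      refine measurableSet_setOf.2 ((measurableSet_setOf.1 (measurableSet_lt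
        (measurable_euclidDist_left c) measurable_const)).and
          (Measurable.forall fun k => measurable_const.imp ?_))
      exact measurableSet_setOf.1 (measurableSet_le measurable_const (measurable_euclidDist_left (x k)))
    -- a point of `B(c, R - ε)` is free unless blocked by one of the `m` frozen centres inside `B`
    have hcover : {q : T3 | Torus.euclidDist q c < R - ε} ⊆ S ∪
        ⋃ k ∈ (Finset.univ.erase l).filter (fun k : Fin n => Torus.euclidDist (x k) c < R),
          {q : T3 | Torus.euclidDist q (x k) < ε} := by
      intro q hq
      have hq' : Torus.euclidDist q c < R - ε := hq
      by_cases hfree : ∀ k, k ≠ l → ε ≤ Torus.euclidDist q (x k)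
      · exact Or.inl ⟨by linarith, hfree⟩
      · push Not at hfree
        obtain ⟨k, hkl, hk⟩ := hfree
        refine Or.inr (mem_biUnion (Finset.mem_filter.2 ⟨Finset.mem_erase.2 ⟨hkl, Finset.mem_univ k⟩,
          ?_⟩) hk)
        calc Torus.euclidDist (x k) c ≤ Torus.euclidDist (x k) q + Torus.euclidDist q c :=
              euclidDist_triangle _ _ _
          _ < ε + (R - ε) := by rw [Torus.euclidDist_comm]; exact add_lt_add hk hq'
          _ = R := by ring
    have hvol : volume {q : T3 | Torus.euclidDist q c < R - ε} ≤
        volume S + m * volume (Metric.ball (0 : V3) ε) := by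
      calc volume {q : T3 | Torus.euclidDist q c < R - ε}
          ≤ volume (S ∪ ⋃ k ∈ (Finset.univ.erase l).filter
              (fun k : Fin n => Torus.euclidDist (x k) c < R), {q : T3 | Torus.euclidDist q (x k) < ε}) :=
            measure_mono hcover
        _ ≤ volume S + volume (⋃ k ∈ (Finset.univ.erase l).filter
              (fun k : Fin n => Torus.euclidDist (x k) c < R), {q : T3 | Torus.euclidDist q (x k) < ε}) :=
            measure_union_le _ _
        _ ≤ volume S + ∑ k ∈ (Finset.univ.erase l).filter
              (fun k : Fin n => Torus.euclidDist (x k) c < R), volume {q : T3 | Torus.euclidDist q (x k) < ε} :=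
            add_le_add le_rfl (measure_biUnion_finset_le _ _)
        _ = volume S + m * volume (Metric.ball (0 : V3) ε) := by
            simp only [Torus.volume_euclidDist_lt hε2, Finset.sum_const, nsmul_eq_mul]
            rw [← hoccl, hx.2]
    have hwS : w ≤ volume S := by
      have hfin : (m : ℝ≥0∞) * volume (Metric.ball (0 : V3) ε) ≠ ⊤ :=
        ENNReal.mul_ne_top (ENNReal.natCast_ne_top m) measure_ball_lt_top.ne
      exact (ENNReal.add_le_add_iff_right hfin).1 (hw.trans hvol)
    -- the left fibre has mass `≤ w`, the right fibre contains the free set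
    have hL : ∫⁻ q, ({x : Fin n → T3 |
          (Finset.univ.filter fun k : Fin n => Torus.euclidDist (x k) c < R).card = m} ∩
        posDomain ε n ∩ {x | ¬Torus.euclidDist (x l) c < R}).indicator (fun _ => w)
        (Function.update x l q) ≤ w := by
      calc _ ≤ ∫⁻ _q : T3, w := lintegral_mono fun q => indicator_le_self _ _ _
        _ = w := by rw [lintegral_const, measure_univ, mul_one]
    have hR : volume S ≤ ∫⁻ q, ({x : Fin n → T3 |
          (Finset.univ.filter fun k : Fin n => Torus.euclidDist (x k) c < R).card = m + 1} ∩
        posDomain ε n ∩ {x | Torus.euclidDist (x l) c < R}).indicator 1 (Function.update x l q) := by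
      rw [← lintegral_indicator_one hSm]
      refine lintegral_mono fun q => ?_
      by_cases hq : q ∈ S
      · have hmem : Function.update x l q ∈ {x : Fin n → T3 |
            (Finset.univ.filter fun k : Fin n => Torus.euclidDist (x k) c < R).card = m + 1} ∩
            posDomain ε n ∩ {x | Torus.euclidDist (x l) c < R} := by
          refine ⟨⟨?_, (update_mem_posDomain_iff ε x l q).2 ⟨hx.1, hq.2⟩⟩, ?_⟩
          · show (Finset.univ.filter fun k : Fin n =>
              Torus.euclidDist (Function.update x l q k) c < R).card = m + 1
            rw [occ_update_eq, if_pos hq.1, ← hoccl, hx.2]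
          · show Torus.euclidDist (Function.update x l q l) c < R
            rw [Function.update_self]
            exact hq.1
        rw [indicator_of_mem hq, indicator_of_mem hmem]
        exact le_rfl
      · rw [indicator_of_notMem hq]
        exact zero_le
    exact hL.trans (hwS.trans hR)
  · -- degenerate fibre: the left integrand vanishes identically
    have h0 : ∀ q, ({x : Fin n → T3 |
          (Finset.univ.filter fun k : Fin n => Torus.euclidDist (x k) c < R).card = m} ∩
        posDomain ε n ∩ {x | ¬Torus.euclidDist (x l) c < R}).indicator (fun _ => w)
        (Function.update x l q) = 0 := by
      intro q
      refine indicator_of_notMem (fun hmem => hx ?_) _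
      obtain ⟨⟨h1, h2⟩, h3⟩ := hmem
      refine ⟨((update_mem_posDomain_iff ε x l q).1 h2).1, ?_⟩
      have h1' : (Finset.univ.filter fun k : Fin n =>
          Torus.euclidDist (Function.update x l q k) c < R).card = m := h1
      have h3' : ¬Torus.euclidDist q c < R := by
        have h3'' : ¬Torus.euclidDist (Function.update x l q l) c < R := h3
        rwa [Function.update_self] at h3''
      rwa [occ_update_eq, if_neg h3', add_zero] at h1'
    rw [lintegral_congr h0, lintegral_zero]
    exact zero_le

/-! ### Summing the fibre inequalities over the moving label -/

/-- Counting identity: if exactly `k` of the events `{p l}` hold at every point of `A`, then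
`∑_l μ(A ∩ {p l}) = k μ(A)`. [folklore] -/
theorem sum_measure_inter_setOf_eq {α : Type*} [MeasurableSpace α] (μ : Measure α) {n : ℕ}
    {A : Set α} (hA : MeasurableSet A) {p : Fin n → α → Prop} [∀ l, DecidablePred (p l)]
    (hp : ∀ l, MeasurableSet {x | p l x}) {k : ℕ}
    (hk : ∀ x ∈ A, (Finset.univ.filter fun l => p l x).card = k) :
    ∑ l, μ (A ∩ {x | p l x}) = k * μ A := by
  calc ∑ l, μ (A ∩ {x | p l x}) = ∑ l, ∫⁻ x, (A ∩ {x | p l x}).indicator 1 x ∂μ := by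
        simp_rw [lintegral_indicator_one (hA.inter (hp _))]
    _ = ∫⁻ x, ∑ l, (A ∩ {x | p l x}).indicator 1 x ∂μ :=
        (lintegral_finsetSum _ fun l _ => measurable_one.indicator (hA.inter (hp l))).symm
    _ = ∫⁻ x, A.indicator (fun _ => (k : ℝ≥0∞)) x ∂μ := by
        refine lintegral_congr fun x => ?_
        by_cases hx : x ∈ A
        · rw [indicator_of_mem hx]
          have h1 : ∀ l, (A ∩ {x | p l x}).indicator (1 : α → ℝ≥0∞) x = if p l x then 1 else 0 := by
            intro l
            by_cases hl : p l x
            · rw [if_pos hl, indicator_of_mem (show x ∈ A ∩ {x | p l x} from ⟨hx, hl⟩), Pi.one_apply]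
            · rw [if_neg hl, indicator_of_notMem (fun h : x ∈ A ∩ {x | p l x} => hl h.2)]
          simp only [h1, Finset.sum_boole, hk x hx]
        · rw [indicator_of_notMem hx]
          exact Finset.sum_eq_zero fun l _ => indicator_of_notMem (fun h : x ∈ A ∩ {x | p l x} => hx h.1) _
    _ = k * μ A := lintegral_indicator_const hA _

/-- **One step of the level comparison (Lebesgue level).** For the ball `B = B(c, R)` and
`E_m = {occ = m}`, `D` the non-overlap set at scale `ε < 1/2`:
`(n − m) · w · vol(E_m ∩ D) ≤ (m + 1) · vol(E_{m+1} ∩ D)` whenever `w + m |B_ε| ≤ vol B(c, R − ε)`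
(sum over the moving label of the fibre inequalities `lintegral_update_occLevel_le`). [folklore] -/
theorem volume_occLevel_step {n : ℕ} {ε R : ℝ} (hε : 0 ≤ ε) (hε2 : ε < 1 / 2) (c : T3) (m : ℕ)
    {w : ℝ≥0∞}
    (hw : w + m * volume (Metric.ball (0 : V3) ε) ≤ volume {q : T3 | Torus.euclidDist q c < R - ε}) :
    ((n - m : ℕ) : ℝ≥0∞) * w * volume ({x : Fin n → T3 |
        (Finset.univ.filter fun k : Fin n => Torus.euclidDist (x k) c < R).card = m} ∩ posDomain ε n) ≤
      ((m : ℝ≥0∞) + 1) * volume ({x : Fin n → T3 |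
        (Finset.univ.filter fun k : Fin n => Torus.euclidDist (x k) c < R).card = m + 1} ∩
          posDomain ε n) := by
  set Em : Set (Fin n → T3) := {x : Fin n → T3 |
    (Finset.univ.filter fun k : Fin n => Torus.euclidDist (x k) c < R).card = m} ∩ posDomain ε n
    with hEm
  set Em1 : Set (Fin n → T3) := {x : Fin n → T3 |
    (Finset.univ.filter fun k : Fin n => Torus.euclidDist (x k) c < R).card = m + 1} ∩ posDomain ε n
    with hEm1
  have hB : ∀ l : Fin n, MeasurableSet {x : Fin n → T3 | Torus.euclidDist (x l) c < R} := fun l =>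
    measurableSet_euclidDist_apply_lt l c R
  have hBc : ∀ l : Fin n, MeasurableSet {x : Fin n → T3 | ¬Torus.euclidDist (x l) c < R} := fun l =>
    (hB l).compl
  have hEmm : MeasurableSet Em := (measurableSet_occ_eq n c R m).inter (measurableSet_posDomain ε n)
  have hEm1m : MeasurableSet Em1 :=
    (measurableSet_occ_eq n c R (m + 1)).inter (measurableSet_posDomain ε n)
  -- `(n - m) vol(E_m ∩ D) = Σ_l vol(E_m ∩ D ∩ {x_l ∉ B})`
  have h1 : ∑ l : Fin n, volume (Em ∩ {x : Fin n → T3 | ¬Torus.euclidDist (x l) c < R}) =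
      ((n - m : ℕ) : ℝ≥0∞) * volume Em := by
    refine sum_measure_inter_setOf_eq volume hEmm (p := fun l x => ¬Torus.euclidDist (x l) c < R) hBc
      fun x hx => ?_
    show (Finset.univ.filter fun l : Fin n => ¬Torus.euclidDist (x l) c < R).card = n - m
    have hcard := Finset.card_filter_add_card_filter_not (s := (Finset.univ : Finset (Fin n)))
      (fun l : Fin n => Torus.euclidDist (x l) c < R)
    rw [Finset.card_univ, Fintype.card_fin] at hcard
    have hxm : (Finset.univ.filter fun k : Fin n => Torus.euclidDist (x k) c < R).card = m := hx.1
    omega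
  -- `(m + 1) vol(E_{m+1} ∩ D) = Σ_l vol(E_{m+1} ∩ D ∩ {x_l ∈ B})`
  have h2 : ∑ l : Fin n, volume (Em1 ∩ {x : Fin n → T3 | Torus.euclidDist (x l) c < R}) =
      ((m + 1 : ℕ) : ℝ≥0∞) * volume Em1 :=
    sum_measure_inter_setOf_eq volume hEm1m (p := fun l x => Torus.euclidDist (x l) c < R) hB
      fun x hx => hx.1
  -- termwise comparison through the fibre over `x_l`
  have h3 : ∀ l : Fin n, w * volume (Em ∩ {x : Fin n → T3 | ¬Torus.euclidDist (x l) c < R}) ≤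
      volume (Em1 ∩ {x : Fin n → T3 | Torus.euclidDist (x l) c < R}) := by
    intro l
    rw [← lintegral_indicator_const (hEmm.inter (hBc l)),
      ← lintegral_indicator_one (hEm1m.inter (hB l))]
    exact lintegral_pi_le_of_update_le (volume : Measure T3) l (fun _ => c)
      (measurable_const.indicator (hEmm.inter (hBc l)))
      (measurable_one.indicator (hEm1m.inter (hB l))) fun x => lintegral_update_occLevel_le hε hε2 c m l hw x
  calc ((n - m : ℕ) : ℝ≥0∞) * w * volume Em
      = w * ∑ l : Fin n, volume (Em ∩ {x : Fin n → T3 | ¬Torus.euclidDist (x l) c < R}) := by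
        rw [h1]; ring
    _ = ∑ l : Fin n, w * volume (Em ∩ {x : Fin n → T3 | ¬Torus.euclidDist (x l) c < R}) :=
        Finset.mul_sum _ _ _
    _ ≤ ∑ l : Fin n, volume (Em1 ∩ {x : Fin n → T3 | Torus.euclidDist (x l) c < R}) :=
        Finset.sum_le_sum fun l _ => h3 l
    _ = ((m : ℝ≥0∞) + 1) * volume Em1 := by rw [h2]; push_cast; ring

/-! ### The canonical measure of the occupation levels -/

/-- The configurational canonical measure with unit activity is `Z⁻¹ vol(· ∩ D)`. [folklore] -/
theorem posGibbsMeasure_one_apply (ε : ℝ) (n : ℕ) {A : Set (Fin n → T3)} (hA : MeasurableSet A) :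
    posGibbsMeasure (fun _ : T3 => (1 : ℝ)) ε n A =
      ENNReal.ofReal (posPartition (fun _ : T3 => (1 : ℝ)) ε n)⁻¹ * volume (A ∩ posDomain ε n) := by
  rw [posGibbsMeasure, withDensity_apply _ hA]
  have h : ∀ x : Fin n → T3, ENNReal.ofReal ((posPartition (fun _ : T3 => (1 : ℝ)) ε n)⁻¹ *
      posWeight (fun _ : T3 => (1 : ℝ)) ε n x) =
      (posDomain ε n).indicator (fun _ => ENNReal.ofReal (posPartition (fun _ : T3 => (1 : ℝ)) ε n)⁻¹) x := by
    intro x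
    unfold posWeight
    by_cases hx : x ∈ posDomain ε n
    · rw [indicator_of_mem hx, indicator_of_mem hx, Finset.prod_const_one, mul_one]
    · rw [indicator_of_notMem hx, indicator_of_notMem hx, mul_zero, ENNReal.ofReal_zero]
  simp_rw [h]
  rw [lintegral_indicator_const (measurableSet_posDomain ε n),
    Measure.restrict_apply (measurableSet_posDomain ε n), inter_comm]

/-- **One step of the level comparison (canonical level).** If moreover
`2 (m + 1) ≤ (n − m) w`, then `2 P(occ = m) ≤ P(occ = m + 1)`. [folklore] -/
theorem posGibbs_occLevel_step {n : ℕ} {ε R : ℝ} (hε : 0 ≤ ε) (hε2 : ε < 1 / 2) (c : T3) (m : ℕ)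
    {w : ℝ≥0∞}
    (hw : w + m * volume (Metric.ball (0 : V3) ε) ≤ volume {q : T3 | Torus.euclidDist q c < R - ε})
    (h2 : 2 * ((m : ℝ≥0∞) + 1) ≤ ((n - m : ℕ) : ℝ≥0∞) * w) :
    2 * posGibbsMeasure (fun _ : T3 => (1 : ℝ)) ε n {x : Fin n → T3 |
        (Finset.univ.filter fun k : Fin n => Torus.euclidDist (x k) c < R).card = m} ≤
      posGibbsMeasure (fun _ : T3 => (1 : ℝ)) ε n {x : Fin n → T3 |
        (Finset.univ.filter fun k : Fin n => Torus.euclidDist (x k) c < R).card = m + 1} := by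
  have hstep := volume_occLevel_step (n := n) hε hε2 c m hw
  set V := volume ({x : Fin n → T3 |
    (Finset.univ.filter fun k : Fin n => Torus.euclidDist (x k) c < R).card = m} ∩ posDomain ε n)
  set V1 := volume ({x : Fin n → T3 |
    (Finset.univ.filter fun k : Fin n => Torus.euclidDist (x k) c < R).card = m + 1} ∩ posDomain ε n)
  have hvol : 2 * V ≤ V1 := by
    have h : ((m : ℝ≥0∞) + 1) * (2 * V) ≤ ((m : ℝ≥0∞) + 1) * V1 :=
      calc ((m : ℝ≥0∞) + 1) * (2 * V) = 2 * ((m : ℝ≥0∞) + 1) * V := by ring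
        _ ≤ ((n - m : ℕ) : ℝ≥0∞) * w * V := mul_le_mul' h2 le_rfl
        _ ≤ ((m : ℝ≥0∞) + 1) * V1 := hstep
    exact (ENNReal.mul_le_mul_iff_right (by simp) (by simp)).1 h
  rw [posGibbsMeasure_one_apply ε n (measurableSet_occ_eq n c R m),
    posGibbsMeasure_one_apply ε n (measurableSet_occ_eq n c R (m + 1)), mul_left_comm]
  exact mul_le_mul' le_rfl hvol

/-- **Registered helper stub `stub_fixedBallVoidLevel`** (first half of V1 of P4, line
`KineticSlabSketch` of crux `JParityClosure.OddContactSymmetry`; = `posGibbs_occLevel_step` in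
signature form): one step of the level comparison for the occupation number of a fixed ball under the
canonical hard-sphere measure with unit activity. [folklore] -/
theorem stub_fixedBallVoidLevel :
    ∀ {n : ℕ} {ε R : ℝ} (_hε : 0 ≤ ε) (_hε2 : ε < 1 / 2) (c : UnitAddTorus (Fin 3)) (m : ℕ) {w : ℝ≥0∞}
    (_hw : w + m * volume (Metric.ball (0 : V3) ε) ≤ volume {q : T3 | Torus.euclidDist q c < R - ε})
    (_h2 : 2 * ((m : ℝ≥0∞) + 1) ≤ ((n - m : ℕ) : ℝ≥0∞) * w),
    2 * posGibbsMeasure (fun _ : T3 => (1 : ℝ)) ε n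
        {x : Fin n → T3 | (Finset.univ.filter fun k : Fin n => Torus.euclidDist (x k) c < R).card = m} ≤
      posGibbsMeasure (fun _ : T3 => (1 : ℝ)) ε n
        {x : Fin n → T3 | (Finset.univ.filter fun k : Fin n => Torus.euclidDist (x k) c < R).card = m + 1} :=
  fun hε hε2 c m _w hw h2 => posGibbs_occLevel_step hε hε2 c m hw h2

end Summit.AtomisticToContinuum.HydrodynamicLimit.Theorems.OddContactSymmetryKineticSlab

end
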